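import Summits.Ventures.CertifiedManyBodySolver.Downfold.EmeryFermiEnergyOf
import Mathlib.Data.Real.Pointwise
import HarnessLib

/-!
# THE SCALING LAW OF THE σ ROW: the antibonding band, the filling map, the Fermi energy and the orbital weights are HOMOGENEOUS under
# `(Δ, t_pd, t_pp, t_pp′, ε) ↦ λ·(Δ, t_pd, t_pp, t_pp′, ε)` — the fixed-doping Fermi-surface shape `t′/t` and the orbital partition are functions
# of the three RATIOS `(Δ/t_pd, t_pp/t_pd, t_pp′/t_pd)` only

Venture CertifiedManyBodySolver, cell `pub/hubbard-downfold` (stage S1; INFLATION-RULES-3to1-B §B.84), seat hubbard-downfold-mod-4 (technique B = band level,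
g35); namespace `Summit.Ventures.CertifiedManyBodySolver.Downfold.Emery`. Everything PROVED (0 sorry, no definition). WHAT THIS IS NOT: a statement about
any material; `U = 0` one-body kinematics of the σ (d–p_x–p_y + t_pp, t_pp′) model; no number lives here.

`EmeryFermiSurfaceShape` §4 proved that the secular cubic is homogeneous of degree 3 (`charCubic_smul`) and that the FIXED-ENERGY shape `fsRatio` is
scale invariant (`fsRatio_smul`). This file lifts the scaling to the objects S2 reads at FIXED DOPING:

* §1 THE BAND: `ε_AB(λΔ, λt_pd, λt_pp, λt_pp′; x, y) = λ·ε_AB(Δ, t_pd, t_pp, t_pp′; x, y)` for `λ > 0` (`abBand_smul`, `abEnergyK_smul`) — the largest root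
  of a cubic whose roots all scale by `λ`.
* §2 THE FILLING: the occupied set at energy `λε` of the scaled row IS the occupied set at `ε` (`abOccSet_smul`), so `abFilling(λθ; λε) = abFilling(θ; ε)`
  (`abFilling_smul`) and the hole indicator is invariant (`holeInd_smul`).
* §3 THE FERMI ENERGY: **`fermiEnergyOf(λθ; ν) = λ·fermiEnergyOf(θ; ν)`** for every filling `ν` and every `λ > 0` (`fermiEnergyOf_smul`; no attainment
  hypothesis — the defining set scales and `sInf (λ • S) = λ·sInf S`).
* §4 THE SHAPE AT FIXED DOPING IS SCALE FREE: **`fsRatio(λθ; fermiEnergyOf(λθ; ν)) = fsRatio(θ; fermiEnergyOf(θ; ν))`** (`fsRatio_fermiEnergyOf_smul`):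
  the one-band `t′/t` of a σ row at hole doping `x` depends on `(Δ, t_pd, t_pp, t_pp′)` only through `(Δ/t_pd, t_pp/t_pd, t_pp′/t_pd)`
  (`fsRatio_fermiEnergyOf_eq_ratios`). Consequences for the cell: a common rescaling of a typed 3BE row (the zeroth-order effect of pressure,
  of a bandwidth renormalisation, or of an eV ↔ t unit change) cannot move object E; over a typed box the t_pd width FOLDS into the other three
  (§B.86, `EmeryShapeTwoRayRule`); and Euler's relation ties the four one-body levers of the shape together (the t_pd lever of §B.85 is the
  Δ- and oxygen levers read backwards).
* §5 THE ORBITAL WEIGHTS: the 2 × 2 minors are homogeneous of degree 2, so the Cu-d weight `dWeight` is scale invariant (`dWeight_smul`), and so is the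
  zone weight `abWeightK` (`abWeightK_smul`): the orbital partition of the holes at fixed doping (§B.81) is a function of the three ratios too.

Sources: three-band model [HybertsenSchluterChristensen1989, Eq. (1)]; contour variables [AndersenEtAl1995, §6]; `sInf` under positive scaling [folklore].
-/

noncomputable section

namespace Summit.Ventures.CertifiedManyBodySolver.Downfold.Emery

open Real MeasureTheory Set
open scoped Pointwise

/-! ## §1 The antibonding band scales -/

section Band

variable {l : ℝ}

/-- **`ε_AB(λθ) = λ·ε_AB(θ)`** pointwise in `(x, y)`, for `λ > 0`: the top root of the scaled secular cubic is `λ` times the top root. [folklore] -/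
theorem abBand_smul (hl : 0 < l) (Δ a b c x y : ℝ) :
    abBand (l * Δ) (l * a) (l * b) (l * c) x y = l * abBand Δ a b c x y := by
  apply le_antisymm
  · -- abBand(λθ)/λ is a root of the original cubic, hence ≤ abBand θ
    set E' := abBand (l * Δ) (l * a) (l * b) (l * c) x y with hE'
    have hroot : charCubic Δ a b c x y (E' / l) = 0 := by
      have h := charCubic_abBand (l * Δ) (l * a) (l * b) (l * c) x y
      rw [← hE', show E' = l * (E' / l) by field_simp, charCubic_smul] at h
      rcases mul_eq_zero.mp h with h3 | h0
      · exact absurd h3 (pow_ne_zero 3 hl.ne')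
      · exact h0
    have hle := le_abBand_of_charCubic_eq_zero hroot
    calc E' = l * (E' / l) := by field_simp
      _ ≤ l * abBand Δ a b c x y := mul_le_mul_of_nonneg_left hle hl.le
  · -- λ·abBand θ is a root of the scaled cubic, hence ≤ abBand(λθ)
    apply le_abBand_of_charCubic_eq_zero
    rw [charCubic_smul, charCubic_abBand, mul_zero]

/-- Zone form: `ε_AB(λθ; k) = λ·ε_AB(θ; k)`. [folklore] -/
theorem abEnergyK_smul (hl : 0 < l) (Δ a b c : ℝ) (k : ℝ × ℝ) :
    abEnergyK (l * Δ) (l * a) (l * b) (l * c) k = l * abEnergyK Δ a b c k := by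
  unfold abEnergyK; exact abBand_smul hl Δ a b c _ _

end Band

/-! ## §2 The filling map scales -/

section Filling

variable {l : ℝ}

/-- **The occupied set of the scaled row at energy `λε` is the occupied set at `ε`.** [folklore] -/
theorem abOccSet_smul (hl : 0 < l) (Δ a b c ε : ℝ) :
    abOccSet (l * Δ) (l * a) (l * b) (l * c) (l * ε) = abOccSet Δ a b c ε := by
  ext k
  simp only [abOccSet, mem_setOf_eq, abBand_smul hl]
  constructor
  · rintro ⟨hk, h⟩; exact ⟨hk, le_of_mul_le_mul_left h hl⟩
  · rintro ⟨hk, h⟩; exact ⟨hk, mul_le_mul_of_nonneg_left h hl.le⟩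

/-- **`abFilling(λθ; λε) = abFilling(θ; ε)`** (`λ > 0`). [folklore] -/
theorem abFilling_smul (hl : 0 < l) (Δ a b c ε : ℝ) :
    abFilling (l * Δ) (l * a) (l * b) (l * c) (l * ε) = abFilling Δ a b c ε := by
  unfold abFilling; rw [abOccSet_smul hl]

/-- Unscaled-energy form: `abFilling(λθ; ε) = abFilling(θ; ε/λ)`. [folklore] -/
theorem abFilling_smul' (hl : 0 < l) (Δ a b c ε : ℝ) :
    abFilling (l * Δ) (l * a) (l * b) (l * c) ε = abFilling Δ a b c (ε / l) := by
  conv_lhs => rw [show ε = l * (ε / l) by field_simp]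
  exact abFilling_smul hl Δ a b c _

/-- The hole indicator is scale invariant: `holeInd(λθ; λε; k) = holeInd(θ; ε; k)`. [folklore] -/
theorem holeInd_smul (hl : 0 < l) (Δ a b c ε : ℝ) (k : ℝ × ℝ) :
    holeInd (l * Δ) (l * a) (l * b) (l * c) (l * ε) k = holeInd Δ a b c ε k := by
  unfold holeInd
  simp only [abEnergyK_smul hl, mul_lt_mul_iff_right₀ hl]

end Filling

/-! ## §3 The Fermi energy scales -/

section Fermi

variable {l : ℝ}

/-- The defining set of `fermiEnergyOf` scales: `{ε ≥ 0 | ν ≤ abFilling(λθ; ε)} = λ • {ε ≥ 0 | ν ≤ abFilling(θ; ε)}`. [folklore] -/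
theorem fermiSet_smul (hl : 0 < l) (Δ a b c ν : ℝ) :
    {ε : ℝ | 0 ≤ ε ∧ ν ≤ abFilling (l * Δ) (l * a) (l * b) (l * c) ε} = l • {ε : ℝ | 0 ≤ ε ∧ ν ≤ abFilling Δ a b c ε} := by
  ext ε
  rw [Set.mem_smul_set]
  simp only [mem_setOf_eq, smul_eq_mul]
  constructor
  · rintro ⟨h0, hν⟩
    refine ⟨ε / l, ⟨div_nonneg h0 hl.le, ?_⟩, by field_simp⟩
    rwa [abFilling_smul' hl] at hν
  · rintro ⟨ε', ⟨h0, hν⟩, rfl⟩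
    refine ⟨mul_nonneg hl.le h0, ?_⟩
    rwa [abFilling_smul hl]

/-- **THE FERMI ENERGY SCALES: `fermiEnergyOf(λθ; ν) = λ·fermiEnergyOf(θ; ν)`** for every filling `ν` and every `λ > 0` (no attainment hypothesis).
[folklore] -/
theorem fermiEnergyOf_smul (hl : 0 < l) (Δ a b c ν : ℝ) :
    fermiEnergyOf (l * Δ) (l * a) (l * b) (l * c) ν = l * fermiEnergyOf Δ a b c ν := by
  unfold fermiEnergyOf
  rw [fermiSet_smul hl, Real.sInf_smul_of_nonneg hl.le, smul_eq_mul]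

/-- Scaling back: `fermiEnergyOf(θ; ν) = fermiEnergyOf(λθ; ν)/λ`. [folklore] -/
theorem fermiEnergyOf_eq_smul_div (hl : 0 < l) (Δ a b c ν : ℝ) :
    fermiEnergyOf Δ a b c ν = fermiEnergyOf (l * Δ) (l * a) (l * b) (l * c) ν / l := by
  rw [fermiEnergyOf_smul hl, mul_div_cancel_left₀ _ hl.ne']

/-- The filling AT the scaled Fermi energy is the filling at the original one. [folklore] -/
theorem abFilling_fermiEnergyOf_smul (hl : 0 < l) (Δ a b c ν : ℝ) :
    abFilling (l * Δ) (l * a) (l * b) (l * c) (fermiEnergyOf (l * Δ) (l * a) (l * b) (l * c) ν) =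
      abFilling Δ a b c (fermiEnergyOf Δ a b c ν) := by
  rw [fermiEnergyOf_smul hl, abFilling_smul hl]

end Fermi

/-! ## §4 The fixed-doping Fermi-surface shape is scale free -/

section Shape

variable {l : ℝ}

/-- **THE FIXED-DOPING SHAPE IS SCALE FREE: `fsRatio(λθ; ε_F(λθ; ν)) = fsRatio(θ; ε_F(θ; ν))`** (`λ > 0`). [folklore] -/
theorem fsRatio_fermiEnergyOf_smul (hl : 0 < l) (Δ a b c ν : ℝ) :
    fsRatio (l * Δ) (l * a) (l * b) (l * c) (fermiEnergyOf (l * Δ) (l * a) (l * b) (l * c) ν) =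
      fsRatio Δ a b c (fermiEnergyOf Δ a b c ν) := by
  rw [fermiEnergyOf_smul hl, fsRatio_smul hl.ne']

/-- **THE SHAPE IS A FUNCTION OF THE THREE RATIOS**: for `t_pd > 0`,
`fsRatio(Δ, t_pd, t_pp, t_pp′; ε_F(ν)) = fsRatio(Δ/t_pd, 1, t_pp/t_pd, t_pp′/t_pd; ε_F(ν))` (each row at its own Fermi energy). [folklore] -/
theorem fsRatio_fermiEnergyOf_eq_ratios {a : ℝ} (ha : 0 < a) (Δ b c ν : ℝ) :
    fsRatio Δ a b c (fermiEnergyOf Δ a b c ν) =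
      fsRatio (Δ / a) 1 (b / a) (c / a) (fermiEnergyOf (Δ / a) 1 (b / a) (c / a) ν) := by
  have h := fsRatio_fermiEnergyOf_smul ha (Δ / a) 1 (b / a) (c / a) ν
  rw [mul_div_cancel₀ _ ha.ne', mul_one, mul_div_cancel₀ _ ha.ne', mul_div_cancel₀ _ ha.ne'] at h
  exact h

/-- The fixed-energy weights at the scaled Fermi energy: `fsD(λθ; ε_F(λθ)) = λ³·fsD(θ; ε_F(θ))`. [folklore] -/
theorem fsD_fermiEnergyOf_smul (hl : 0 < l) (Δ a b c ν : ℝ) :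
    fsD (l * Δ) (l * a) (l * c) (fermiEnergyOf (l * Δ) (l * a) (l * b) (l * c) ν) = l ^ 3 * fsD Δ a c (fermiEnergyOf Δ a b c ν) := by
  rw [fermiEnergyOf_smul hl, fsD_smul]

/-- `fsN(λθ; ε_F(λθ)) = λ³·fsN(θ; ε_F(θ))`. [folklore] -/
theorem fsN_fermiEnergyOf_smul (hl : 0 < l) (Δ a b c ν : ℝ) :
    fsN (l * a) (l * b) (l * c) (fermiEnergyOf (l * Δ) (l * a) (l * b) (l * c) ν) = l ^ 3 * fsN a b c (fermiEnergyOf Δ a b c ν) := by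
  rw [fermiEnergyOf_smul hl, fsN_smul]

end Shape

/-! ## §5 The orbital weights are scale invariant -/

section Weights

variable {l : ℝ}

/-- `minorD` is homogeneous of degree 2. [folklore] -/
theorem minorD_smul (l Δ b c x y t : ℝ) : minorD (l * Δ) (l * b) (l * c) x y (l * t) = l ^ 2 * minorD Δ b c x y t := by
  unfold minorD; ring

/-- `minorX` is homogeneous of degree 2. [folklore] -/
theorem minorX_smul (l Δ a c y t : ℝ) : minorX (l * Δ) (l * a) (l * c) y (l * t) = l ^ 2 * minorX Δ a c y t := by
  unfold minorX; ring

/-- `minorY` is homogeneous of degree 2. [folklore] -/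
theorem minorY_smul (l Δ a c x t : ℝ) : minorY (l * Δ) (l * a) (l * c) x (l * t) = l ^ 2 * minorY Δ a c x t := by
  unfold minorY; ring

/-- **The Cu-d weight is scale invariant**: `dWeight(λθ; x, y; λt) = dWeight(θ; x, y; t)` (`λ ≠ 0`). [folklore] -/
theorem dWeight_smul (hl : l ≠ 0) (Δ a b c x y t : ℝ) :
    dWeight (l * Δ) (l * a) (l * b) (l * c) x y (l * t) = dWeight Δ a b c x y t := by
  unfold dWeight
  rw [minorD_smul, minorX_smul, minorY_smul, ← mul_add, ← mul_add, mul_div_mul_left _ _ (pow_ne_zero 2 hl)]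

/-- **The zone d-weight of the antibonding state is scale invariant**: `abWeightK(λθ; k) = abWeightK(θ; k)` (`λ > 0`). [folklore] -/
theorem abWeightK_smul (hl : 0 < l) (Δ a b c : ℝ) (k : ℝ × ℝ) :
    abWeightK (l * Δ) (l * a) (l * b) (l * c) k = abWeightK Δ a b c k := by
  unfold abWeightK
  rw [abEnergyK_smul hl, dWeight_smul hl.ne']

/-- Hence the hole contents at the scaled Fermi level are unchanged: `dHole(λθ; λε) = dHole(θ; ε)`. [folklore] -/
theorem dHole_smul (hl : 0 < l) (Δ a b c ε : ℝ) :
    dHole (l * Δ) (l * a) (l * b) (l * c) (l * ε) = dHole Δ a b c ε := by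
  unfold dHole
  simp only [holeInd_smul hl, abWeightK_smul hl]

/-- `pHole(λθ; λε) = pHole(θ; ε)`. [folklore] -/
theorem pHole_smul (hl : 0 < l) (Δ a b c ε : ℝ) :
    pHole (l * Δ) (l * a) (l * b) (l * c) (l * ε) = pHole Δ a b c ε := by
  unfold pHole
  simp only [holeInd_smul hl, abWeightK_smul hl]

/-- `nHole(λθ; λε) = nHole(θ; ε)`. [folklore] -/
theorem nHole_smul (hl : 0 < l) (Δ a b c ε : ℝ) :
    nHole (l * Δ) (l * a) (l * b) (l * c) (l * ε) = nHole Δ a b c ε := by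
  unfold nHole
  simp only [holeInd_smul hl]

/-- **THE ORBITAL PARTITION AT FIXED DOPING IS SCALE FREE**: `dHole(λθ; ε_F(λθ; ν)) = dHole(θ; ε_F(θ; ν))`. [folklore] -/
theorem dHole_fermiEnergyOf_smul (hl : 0 < l) (Δ a b c ν : ℝ) :
    dHole (l * Δ) (l * a) (l * b) (l * c) (fermiEnergyOf (l * Δ) (l * a) (l * b) (l * c) ν) = dHole Δ a b c (fermiEnergyOf Δ a b c ν) := by
  rw [fermiEnergyOf_smul hl, dHole_smul hl]

/-- `pHole(λθ; ε_F(λθ; ν)) = pHole(θ; ε_F(θ; ν))`. [folklore] -/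
theorem pHole_fermiEnergyOf_smul (hl : 0 < l) (Δ a b c ν : ℝ) :
    pHole (l * Δ) (l * a) (l * b) (l * c) (fermiEnergyOf (l * Δ) (l * a) (l * b) (l * c) ν) = pHole Δ a b c (fermiEnergyOf Δ a b c ν) := by
  rw [fermiEnergyOf_smul hl, pHole_smul hl]

end Weights

end Summit.Ventures.CertifiedManyBodySolver.Downfold.Emery
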